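import Literature.AlgebraicGeometry.Motives.AbelianVarietyGoodReductionConjFrobTateCompat
import Literature.AlgebraicGeometry.Motives.AbelianVarietyConjFrobTwistedReductionMap
import HarnessLib

/-!
# The twisted-reduction Tate compatibility «Q5» is a THEOREM
# (Shimura 1998, §18.6 proof of Thm. 18.6, p. 129 «`(Y^σ)~ = Ỹ^f` … `(t^σ)~ = π(t̃)`»; §11.1 Prop. 14 (i))

Topic `Literature/AlgebraicGeometry/Motives`; namespace `Literature.NumberTheory.DiophantineGeometry.IsAbelianSchemeModel`
(the convention of the fact's own file `AbelianSchemeModelTwistedReductionTate.lean`, ★ p621613).  THEOREMS ONLY; net Literature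
debt **−1**: the named fact `IsAbelianSchemeModel.forall_isTateCompatible_homReduction_conjFrob_tateSpecialisation` («Q5», row II-1 of
the cell `hodgecm-mathlib`, the `h21` floor binder of `hc_cm_of_floor_v6`) is DISCHARGED.  Cell `hodgecm-mathlib` (D-0151), edition E4
«S5c′ ↦ Q5 ↦ ∅»; custodian B-p09, closer B-p20 (RULING 4 (4), 2026-08-28T10:31:56Z).  Every input BY NAME:

* ★ p623807 `forall_isTateCompatible_homReduction_conjFrob_tateSpecialisation_of_twistedReductionMap` (B-p15): the named fact from
  the ONE twisted-reduction identity (TW) «`red_{(𝒜ₐ-datum)^γ}(y^σ̃) = π(red_v y)`» on `Aₐ(K̄)`, via the naturality of the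
  reduction map of any good-reduction datum (B-p15 ★ p621485) and the `T_ℓ` bookkeeping of B-p07 ★ p620831;
* (TW) itself: `IsAbelianSchemeModel.twistedReductionMap_global` (A-p04, `AbelianVarietyConjFrobTwistedReductionMap`) = B-p07's composition
  ★ p627931 `twistedReductionMap_of_frobeniusTranslate` ((G0)/(G1) readings, twist step, B-p15 ★ p624872 conjReductionIso reading over A-p14
  ★ p624659, B-p15 (C) ★ p621485) at the φ-light slot `GoodReductionAt.SlotT3`, discharged by A-p04 from A-p14 ★ p625085 (Frobenius
  translate at the base point, over B-p19 ★ p620854 and B-p09 ★ p624844).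

HC_CM is proved only modulo the 7 printed citations until rung 0 closes; with this file the `h21` leg of the floor no longer cites
[Shimura1998 §18.6 «(Y^σ)~ = Ỹ^f»] as a hypothesis — Q5 leaves the floor.

## References
* [Shimura1998] G. Shimura, *Abelian Varieties with Complex Multiplication and Modular Functions*, Princeton 1998:
  §18.6 proof of Thm. 18.6 (pp. 128–130); §11.1 Prop. 12 and Prop. 14 (i).
* [SerreTate1968] J.-P. Serre, J. Tate, *Good reduction of abelian varieties*, Ann. of Math. 88 (1968), §1 Lemma 2, Thm. 1.
-/

set_option autoImplicit false

noncomputable section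

open CategoryTheory AlgebraicGeometry IsDedekindDomain IsDedekindDomain.HeightOneSpectrum
open scoped NumberField
open Literature.NumberTheory.EllipticCurves Literature.NumberTheory.GaloisRepresentations
open Literature.AlgebraicGeometry.Motives Literature.AlgebraicGeometry.Motives.AbelianVariety

namespace Literature.NumberTheory.DiophantineGeometry

namespace IsAbelianSchemeModel

/-- **Q5 holds** — [Shimura1998] §18.6 p. 129 «`(Y^σ)~ = Ỹ^f`, `(t^σ)~ = π(t̃)`» read on Tate modules: for every pair of
abelian-scheme models at `v`, every arithmetic Frobenius `γ` at `v` with `q = pⁿ`, every Frobenius `σ̃ ∈ Aut K̄` over `γ` at the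
produced prime and every `ℓ ∤ v`, ALL companion data `Hγ : Aᵢ → (Aₐ)^γ`, `Hγ′ : (Aₐ)^γ → Aᵢ` are Tate-compatible with the produced
specialisation datum of `Aᵢ` and the transported one of `(Aₐ)^γ`.  Proof: ★ p623807 applied to the twisted-reduction identity (TW)
`IsAbelianSchemeModel.twistedReductionMap_global` (`AbelianVarietyConjFrobTwistedReductionMap`).
[cite: Shimura1998, §18.6 proof of Thm. 18.6 (pp. 128–130); §11.1 Prop. 14 (i)] [cite: SerreTate1968, §1 Lemma 2] -/
theorem forall_isTateCompatible_homReduction_conjFrob_tateSpecialisation_holds :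
    forall_isTateCompatible_homReduction_conjFrob_tateSpecialisation :=
  forall_isTateCompatible_homReduction_conjFrob_tateSpecialisation_of_twistedReductionMap twistedReductionMap_global

end IsAbelianSchemeModel

end Literature.NumberTheory.DiophantineGeometry

end
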